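import Summits.AnomalousDissipation.AnomalousDissipation.Theorems.SawtoothPulseCascadeK1LocalisedCascadeCanonicalRatioStepsOsc
import Summits.AnomalousDissipation.AnomalousDissipation.Theorems.SawtoothPulseCascadeK1LocalisedCascadeCanonicalBlocksMax

/-!
# K1loc — THE (C-H) STEP AT AN ARBITRARY WINDOW `K`, OSCILLATORY GRADE (numeric layer)

Prover lane on the crux `K1LocalisedCascade` (stmt-AnomalousDissipation-19491), route `SawtoothPulseCascade`
(S-B/S-C assembly seat; the LEDGER ASSEMBLY, numeric layer, Osc grade).  The sub-cone step (C-H) at shape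
`γ = 8, d = 2, N₀ = 1, ρ_N = 2` for an ARBITRARY `K ≥ 6`: the feed class of `…PhaseSVOsc` / `…PhaseOVOsc`,
`C_j = Σ'[3K+1 ≤ |k₀| ∧ |k₁| ≤ 3|k₀|]‖𝓕b_j‖²` (slope `(1,3)`, threshold = fibre floor `Λ₀ = 3K+1`), margin `3`, `max`-family
cut-offs `t = 1`, fed by the shell class `A_j(3K+1) = Σ'[3K+1 ≤ |k₀| ∧ |k₀| ≤ 2|k₁|]‖𝓕a_j‖²` (the class bounded by
`…ShellChainOsc` at `Y = 3K+1 ≥ 19`), `M_b = 7j + 19`, `η = (ε/(7·8π·2^19·(3K+1)))·64^{−j}`, over ad-sawtooth-k1loc-p1's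
OSCILLATORY window blocks (`…CanonicalRatioStepsOsc.ratioClass_hstep_canonicalOsc_le`): `r* = 77/37`, `A* = 7`, `D₀ = 2(3K+1)`:
  `C_j ≤ (√J_C + √A_j(3K+1))² + ((1+γ)^{2j}/((3K+1)·2^{7j+19}))²`,
  `J_C = 3(77/37)²((4/3)ε² + (4/3)(2·2^j/(πD₀))² + 56·2^j/(πD₀) + (7j+19)(392·2^j·√(4Mδ_j/(πD₀)) + 392·Mδ_j/π))`.
No definitions; no statement about the crux. [cite: Grafakos2014, Prop. 3.1.2 (5), Prop. 3.2.7 (3), §3.1.3] [problem: turb]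
-/

-- `Summit.<Summit>.<Problem>`: single-conjunct summit, the duplicate namespace segment is deliberate.
set_option linter.dupNamespace false

noncomputable section

namespace Summit.AnomalousDissipation.AnomalousDissipation.Theorems.SawtoothPulseCascade.K1Window

open MeasureTheory Set Filter Topology UnitAddTorus Function Complex Metric
open scoped Real ENNReal
open Literature.Analysis Literature.Analysis.FunctionSpaces Literature.Analysis.FunctionSpaces.Torus Literature.Analysis.FluidPDE
open Literature.Analysis.FluidPDE.ShearStage
open Literature.Analysis.FluidPDE.SawtoothCascade Literature.Analysis.FluidPDE.SawtoothCascade.CascadeParams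
open Summit.AnomalousDissipation.AnomalousDissipation.Theorems.SawtoothPulseCascade.K1Start
open Summit.AnomalousDissipation.AnomalousDissipation.Theorems.SawtoothPulseCascade.K1Flat
open Summit.AnomalousDissipation.AnomalousDissipation.Theorems.SawtoothPulseCascade.K1Ledger.From

/-- **The plain cut-off ratio of the (C-H) blocks** (max family, `t = 1`, `Y₀ = 0`, `β = 3`, `Λ₀ ≥ 19`): `r_m ≤ 77/37`. [folklore] -/
theorem ch_cutoff_le {Λ0 : ℕ} (hΛ0 : 19 ≤ Λ0) (m : ℕ) :
    (((max (2 * 1 * (Λ0 * 2 ^ m) / 2) 0 : ℕ) : ℝ) + ((3 * (Λ0 * 2 ^ m) / 1 : ℕ) : ℝ)) /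
        (((3 * (Λ0 * 2 ^ m) / 1 : ℕ) : ℝ) - ((max (2 * 1 * (Λ0 * 2 ^ m) / 2) 0 : ℕ) : ℝ)) ≤ 77 / 37 := by
  have h1 : 2 * 1 * 1 ≤ 1 * 2 := by norm_num
  have h2 : 0 * 1 ≤ 1 * Λ0 := by simp
  have h3 : 1 * 1 * Λ0 + 2 * 1 * 1 ≤ 3 * 1 * Λ0 := by omega
  have hr := canonMax_r_le (u' := 1) (v' := 2) (Y₀ := 0) (tn := 1) (td := 1) (qn := 3) (qd := 1) (Λ0 := Λ0)
    (by norm_num) (by norm_num) (by norm_num) h1 h2 h3 m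
  have hΛ0r : (19 : ℝ) ≤ Λ0 := by exact_mod_cast hΛ0
  have hden : (0 : ℝ) < (((3 : ℕ) : ℝ) / ((1 : ℕ) : ℝ) - ((1 : ℕ) : ℝ) / ((1 : ℕ) : ℝ)) * (Λ0 : ℝ) - 1 := by
    push_cast; linarith
  have hrs : ((((1 : ℕ) : ℝ) / ((1 : ℕ) : ℝ) + ((3 : ℕ) : ℝ) / ((1 : ℕ) : ℝ)) * (Λ0 : ℝ) + 1) /
      ((((3 : ℕ) : ℝ) / ((1 : ℕ) : ℝ) - ((1 : ℕ) : ℝ) / ((1 : ℕ) : ℝ)) * (Λ0 : ℝ) - 1) ≤ 77 / 37 := by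
    rw [div_le_iff₀ hden]
    push_cast; linarith
  exact hr.trans hrs

section Cascade

variable (P : CascadeParams)

set_option maxHeartbeats 400000 in
/-- **(C-H) AT AN ARBITRARY WINDOW, OSCILLATORY GRADE** (see the file header): for every phase `j` and every `K ≥ 6`,
`C_j(3K+1) ≤ (√J_C + √A_j(3K+1))² + ((1+γ)^{2j}/((3K+1)2^{7j+19}))²`. [cite: Grafakos2014, Prop. 3.1.2 (5), Prop. 3.2.7 (3), §3.1.3] -/
theorem subcone_hstep_osc_le (hγ : P.γ = 8) (hδ₀ : 0 < P.δ₀) (hd : P.d = 2) (hN₀ : P.N₀ = 1) (hρN : P.ρN = 2)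
    (a b : ℕ → UnitAddTorus (Fin 2) → ℝ) (has : ∀ j, IsSmooth (a j)) (h0 : a 0 = datum)
    (hb : ∀ j, b j = a j ∘ shearMap 0 1 (amp ⟨P.U j, P.U_periodic j, P.contDiff_U (P.δ_pos hδ₀ (by rw [hd]; norm_num) j)⟩ P.γ))
    (hab : ∀ j, a (j + 1) = b j ∘ shearMap 1 0 (amp ⟨P.U j, P.U_periodic j, P.contDiff_U (P.δ_pos hδ₀ (by rw [hd]; norm_num) j)⟩ P.γ))
    {K : ℕ} (hK : 6 ≤ K) {ε : ℝ} (hε : 0 < ε) (j : ℕ)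
    (hMδ : max 1 (Real.sqrt (2 * Real.log (1 / (ε / (7 * π * 8 * 2 ^ 19 * ((3 * K + 1 : ℕ) : ℝ)) * (1 / 64) ^ j)))) * P.δ j < π / 2) :
    ∑' k : Fin 2 → ℤ, (if ((3 * K + 1 : ℕ) : ℤ) ≤ |k 0| ∧ ((1 : ℕ) : ℤ) * |k 1| ≤ ((3 : ℕ) : ℤ) * |k 0| then (1 : ℝ) else 0) *
        ‖mFourierCoeff (fun x => (b j x : ℂ)) k‖ ^ 2 ≤
      (Real.sqrt (3 * (77 / 37) ^ 2 *
            (4 / 3 * ε ^ 2 + 4 / 3 * (2 * 2 ^ j / (π * (2 * ((3 * K + 1 : ℕ) : ℝ)))) ^ 2 + 8 * 2 ^ j * 7 / (π * (2 * ((3 * K + 1 : ℕ) : ℝ))) +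
              ((7 * j + 19 : ℕ) : ℝ) * (8 * 2 ^ j * 7 ^ 2 *
                Real.sqrt (4 * (max 1 (Real.sqrt (2 * Real.log (1 / (ε / (7 * π * 8 * 2 ^ 19 * ((3 * K + 1 : ℕ) : ℝ)) * (1 / 64) ^ j)))) * P.δ j) / (π * (2 * ((3 * K + 1 : ℕ) : ℝ)))) +
                8 * 7 ^ 2 * (max 1 (Real.sqrt (2 * Real.log (1 / (ε / (7 * π * 8 * 2 ^ 19 * ((3 * K + 1 : ℕ) : ℝ)) * (1 / 64) ^ j)))) * P.δ j) / π))) +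
          Real.sqrt (∑' k : Fin 2 → ℤ, (if ((3 * K + 1 : ℕ) : ℤ) ≤ |k 0| ∧ ((1 : ℕ) : ℤ) * |k 0| ≤ ((2 : ℕ) : ℤ) * |k 1|
            then (1 : ℝ) else 0) * ‖mFourierCoeff (fun x => (a j x : ℂ)) k‖ ^ 2)) ^ 2 +
        ((1 + P.γ) ^ (2 * j) / (((3 * K + 1) * 2 ^ (7 * j + 19) : ℕ) : ℝ)) ^ 2 := by
  have hΛ0 : 19 ≤ 3 * K + 1 := by omega
  have hΛ01 : 1 ≤ 3 * K + 1 := le_trans (by norm_num) hΛ0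
  have hΛ0r : (19 : ℝ) ≤ ((3 * K + 1 : ℕ) : ℝ) := by exact_mod_cast hΛ0
  have hΛ0pos : (0 : ℝ) < ((3 * K + 1 : ℕ) : ℝ) := by linarith
  have hγ' : P.γ = ((8 : ℕ) : ℝ) := by rw [hγ]; norm_num
  have hd' : 0 < P.d := by rw [hd]; norm_num
  have hN₀' : 1 ≤ P.N₀ := by rw [hN₀]
  have hρN' : 1 ≤ P.ρN := by rw [hρN]; norm_num
  have hNj : (P.N j : ℝ) = 2 ^ j := by rw [CascadeParams.N, hN₀, hρN]; push_cast; ring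
  have h1 : 2 * 1 * 1 ≤ 1 * 2 := by norm_num
  have h2 : 0 * 1 ≤ 1 * (3 * K + 1) := by simp
  have h3 : 1 * 1 * (3 * K + 1) + 2 * 1 * 1 ≤ 3 * 1 * (3 * K + 1) := by omega
  set η : ℝ := (ε / (7 * π * 8 * 2 ^ 19 * ((3 * K + 1 : ℕ) : ℝ)) * (1 / 64) ^ j) with hη
  have hπ := Real.pi_pos
  have hηpos : 0 < η := by rw [hη]; positivity
  have hstep := ratioClass_hstep_canonicalOsc_le P hγ' hδ₀ hd' hN₀' hρN' a b has h0 hb hab j (u := 1) (v := 3)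
    (u' := 1) (v' := 2) (Y := 3 * K + 1) (qn := 3) (qd := 1) (Λ0 := 3 * K + 1) (by norm_num) (by norm_num) (by norm_num)
    (by norm_num) (by norm_num) hΛ01 le_rfl (fun m => max (2 * 1 * ((3 * K + 1) * 2 ^ m) / 2) 0)
    (fun m => canonMax_Q₁_lt_Q₂ (by norm_num) (by norm_num) (by norm_num) h1 h2 h3 m)
    (fun m => canonMax_feed (by norm_num) 0 (3 * K + 1) m) (rs := 77 / 37) (fun m => ch_cutoff_le hΛ0 m) (7 * j + 19)
    hηpos hMδ
  -- the exact constants at `(u,v,q_n,q_d) = (1,3,3,1)`: `A* = 7`, `D₀ = 2Λ₀`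
  have eratio : ((((3 : ℕ) : ℝ) + ((1 : ℕ) : ℝ) * ((8 : ℕ) : ℝ)) * ((1 : ℕ) : ℝ) + ((1 : ℕ) : ℝ) * ((3 : ℕ) : ℝ)) /
      ((((1 : ℕ) : ℝ) * ((8 : ℕ) : ℝ) - ((3 : ℕ) : ℝ)) * ((1 : ℕ) : ℝ) - ((1 : ℕ) : ℝ) * ((3 : ℕ) : ℝ)) = 7 := by
    push_cast; norm_num
  have eD : ((((1 : ℕ) : ℝ) * ((8 : ℕ) : ℝ) - ((3 : ℕ) : ℝ)) * ((1 : ℕ) : ℝ) - ((1 : ℕ) : ℝ) * ((3 : ℕ) : ℝ)) * ((3 * K + 1 : ℕ) : ℝ) /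
      (((1 : ℕ) : ℝ) * ((1 : ℕ) : ℝ)) = 2 * ((3 * K + 1 : ℕ) : ℝ) := by
    push_cast; ring
  refine le_sq_sqrt_add_mono hstep ?_
  rw [eratio, eD, hNj]
  have hX : (7 : ℝ) * π * ((8 : ℕ) : ℝ) * η * ((3 * K + 1 : ℕ) : ℝ) / 2 ^ j * 2 ^ (7 * j + 19) = ε := by
    have e2 : (2 : ℝ) ^ (7 * j + 19) = 2 ^ 19 * 128 ^ j := by
      rw [pow_add, pow_mul]; norm_num; ring
    have p1 : ((1 : ℝ) / 64) ^ j * (128 : ℝ) ^ j = (2 : ℝ) ^ j := by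
      rw [← mul_pow]; norm_num
    have hne1 : (7 : ℝ) * Real.pi * 8 * 2 ^ 19 * ((3 * K + 1 : ℕ) : ℝ) ≠ 0 := by positivity
    have hne2 : (2 : ℝ) ^ j ≠ 0 := pow_ne_zero _ two_ne_zero
    rw [hη, e2]
    calc (7 : ℝ) * π * ((8 : ℕ) : ℝ) * (ε / (7 * π * 8 * 2 ^ 19 * ((3 * K + 1 : ℕ) : ℝ)) * (1 / 64) ^ j) * ((3 * K + 1 : ℕ) : ℝ) / 2 ^ j *
          (2 ^ 19 * 128 ^ j)
        = ε * (((7 : ℝ) * Real.pi * 8 * 2 ^ 19 * ((3 * K + 1 : ℕ) : ℝ)) / (7 * Real.pi * 8 * 2 ^ 19 * ((3 * K + 1 : ℕ) : ℝ))) *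
            ((((1 : ℝ) / 64) ^ j * 128 ^ j) / 2 ^ j) := by
          push_cast; field_simp
      _ = ε := by rw [p1, div_self hne1, div_self hne2]; ring
  rw [hX]

end Cascade

end Summit.AnomalousDissipation.AnomalousDissipation.Theorems.SawtoothPulseCascade.K1Window
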